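import Summits.CriticalPhenomena.PercolationContinuityZ3.Theorems.PercNearOneGluingNoHeavyLowerTailSahiCombTriWAndMaj3Cols

/-!
# AND with a majority-of-three block: `P₁ ∧ maj₃` is an intersecting Kleitman shell whenever `P₁` is

Support file of the one-cut programme (crux `NoHeavyLowerTail`, stmt-CriticalPhenomena-4575; unit `prim-lf-1` gen 43, memo
`FROM-prim-lf-1-gen43-AND-MAJ3.md`).  Continuation of `…SahiCombTriWAndProd` (gen 41: `andProd`, the typed conjecture `AndShellLower`),
of the CONE THEOREM `…SahiCombTriWCone`, and of part 1 `…SahiCombTriWAndMaj3Cols`.  The first AND-product theorem with TWO non-trivial blocks.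

Setting: `P₁ ⊆ 2^{γ₁}` an antipode-free up-set with `Cor_{P₁}(U,V) ≥ 0` for all up-sets `U, V` (an INTERSECTING KLEITMAN SHELL: principal
families, `maj`, co-covering generators, near-unanimity thresholds, self-dual families, AND-products already certified, …), and
`maj3 = {y ⊆ Fin 3 | 2 ≤ #y}`.
* **`corP_andProd_maj3_nonneg`**: `Cor_{P₁ ∧ maj3}(A,B) ≥ 0` for all up-sets `A, B` of the product cube `2^{γ₁ ⊕ Fin 3}`
  (`…_of_klShell`: hypothesis in Kleitman-shell form).
* `klShell_andProd_maj3`, **`triW_nonneg_andProd_maj3`**: the AND-product is again an intersecting Kleitman shell and satisfies `TriWIneq`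
  on every index cube; the statement ITERATES (`corP_andProd_maj3_maj3_nonneg`) and combines with the cone / OR-product / relabeling theorems;
  example `maj3 ∧ maj3` (`corP_maj3_andProd_maj3_nonneg`, `n = 6`).
* Tool (`sum_mul_nonneg_of_unit`, `sum_mul_nonneg_of_two`, `sgnDiff_realize_eq`): an increasing `{−1,0,1}`-valued vector `w` on `P₁` with
  `w(x)+w(x') ≥ 0` whenever `x ∪ x' = ⊤` is the `δ`-vector of the up-set `realize P₁ w`, so two such vectors (or vectors with values in
  `[-2,2]`, by layers) have non-negative inner product over `P₁` when `Cor_{P₁} ≥ 0`.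

Proof ("sorted profiles", part 1 notation).  `Cor = Σ_{x∈P₁}[uu' + Σ_i w_iw'_i]`; pointwise `Σ_i w_iw'_i ≥ ℓM' + mm' + Mℓ'` (rearrangement);
then `2(uu'+ℓM'+mm'+Mℓ') = (u+M)(ℓ'+m') + (ℓ+m)(u'+M') + [pointwise ≥ 0]`, and `Σ_{x∈P₁}(u+M)(ℓ'+m') ≥ 0`, `Σ(ℓ+m)(u'+M') ≥ 0` by the tool,
since `u+M`, `ℓ+m` are increasing with the pair condition.  (The same argument proves `V₁ × claw_k` good for every "good" `V₁` in the
abstract poset setting; `maj3` is `claw_3`.)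
HONEST LABEL: complete proofs, std axioms; a new infinite stratum of `TriWIneq`; the general AND conjecture `AndShellLower` stays OPEN. [this work]
-/

namespace Summit.CriticalPhenomena.PercolationContinuityZ3.Theorems

namespace FiveUpSet

open Finset

variable {β γ₁ : Type} [DecidableEq β] [Fintype β] [DecidableEq γ₁] [Fintype γ₁]

/-! ### Realizing `{−1,0,1}`-valued profile vectors as `δ`-vectors of up-sets, and the acuteness consequences -/

section realize
variable {P₁ : Finset (Finset γ₁)} (hP : IsUpperSet (P₁ : Set (Finset γ₁))) (hd : Disjoint P₁ (refl P₁))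

/-- The up-set realizing a `{−1,0,1}`-valued increasing vector `w` on `P₁`: `↑{x ∈ P₁ | w x = 1} ∪ ↑{xᶜ | x ∈ P₁, w x = −1}`. [this work] -/
def realize (P₁ : Finset (Finset γ₁)) (w : Finset γ₁ → ℤ) : Finset (Finset γ₁) :=
  univ.filter fun t => (∃ x ∈ P₁, x ⊆ t ∧ w x = 1) ∨ (∃ x ∈ P₁, xᶜ ⊆ t ∧ w x = -1)

/-- `realize P₁ w` is an up-set. [this work] -/
theorem isUpperSet_realize (P₁ : Finset (Finset γ₁)) (w : Finset γ₁ → ℤ) : IsUpperSet (realize P₁ w : Set (Finset γ₁)) := by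
  intro t t' htt' ht
  simp only [realize, coe_filter, mem_univ, true_and, Set.mem_setOf_eq] at ht ⊢
  rcases ht with ⟨x, hx, hxt, hw⟩ | ⟨x, hx, hxt, hw⟩
  · exact Or.inl ⟨x, hx, hxt.trans htt', hw⟩
  · exact Or.inr ⟨x, hx, hxt.trans htt', hw⟩

include hP hd in
/-- **Realization lemma.**  An increasing `{−1,0,1}`-valued vector on an antipode-free up-set `P₁` whose values at any two points covering
`⊤` have non-negative sum is the `δ`-vector `x ↦ [x ∈ U] − [xᶜ ∈ U]` of the up-set `U = realize P₁ w`. [this work] -/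
theorem sgnDiff_realize_eq (w : Finset γ₁ → ℤ) (hval : ∀ x ∈ P₁, w x = -1 ∨ w x = 0 ∨ w x = 1)
    (hmono : ∀ x ∈ P₁, ∀ x' ∈ P₁, x ⊆ x' → w x ≤ w x') (hpair : ∀ x ∈ P₁, ∀ x' ∈ P₁, x ∪ x' = univ → 0 ≤ w x + w x')
    {x : Finset γ₁} (hx : x ∈ P₁) : sgnDiff (realize P₁ w) (refl (realize P₁ w)) x = w x := by
  rw [sgnDiff_refl_eq]
  have hmem : x ∈ realize P₁ w ↔ w x = 1 := by
    simp only [realize, mem_filter, mem_univ, true_and]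
    constructor
    · rintro (⟨x₀, hx₀, hsub, hw⟩ | ⟨x₀, hx₀, hsub, hw⟩)
      · have h1 := hmono x₀ hx₀ x hx hsub
        rcases hval x hx with h | h | h <;> omega
      · have hu : x₀ ∪ x = univ := by
          apply eq_univ_of_forall; intro a; rw [mem_union]
          by_cases ha : a ∈ x₀
          · exact Or.inl ha
          · exact Or.inr (hsub (mem_compl.2 ha))
        have h1 := hpair x₀ hx₀ x hx hu
        rcases hval x hx with h | h | h <;> omega
    · intro h; exact Or.inl ⟨x, hx, Subset.rfl, h⟩
  have hmem' : xᶜ ∈ realize P₁ w ↔ w x = -1 := by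
    simp only [realize, mem_filter, mem_univ, true_and]
    constructor
    · rintro (⟨x₀, hx₀, hsub, hw⟩ | ⟨x₀, hx₀, hsub, hw⟩)
      · -- `x₀ ⊆ xᶜ` with `x₀, x ∈ P₁` contradicts antipode-freeness
        exfalso
        have hxc : xᶜ ∈ P₁ := hP hsub hx₀
        have : x ∈ refl P₁ := mem_refl.2 hxc
        exact disjoint_left.1 hd hx this
      · have hsub' : x ⊆ x₀ := by
          intro a ha; by_contra hna
          exact (mem_compl.1 (hsub (mem_compl.2 hna))) ha
        have h1 := hmono x hx x₀ hx₀ hsub'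
        rcases hval x hx with h | h | h <;> omega
    · intro h; exact Or.inr ⟨x, hx, Subset.rfl, h⟩
  unfold ind
  rcases hval x hx with h | h | h
  · rw [if_neg (fun h' => by rw [hmem] at h'; omega), if_pos (hmem'.2 h)]; omega
  · rw [if_neg (fun h' => by rw [hmem] at h'; omega), if_neg (fun h' => by rw [hmem'] at h'; omega)]; omega
  · rw [if_pos (hmem.2 h), if_neg (fun h' => by rw [hmem'] at h'; omega)]; omega

include hP hd in
/-- **Acuteness for realizable vectors**: two increasing `{−1,0,1}`-valued vectors with the pair condition have non-negative inner
product over `P₁`, provided `Cor_{P₁} ≥ 0` on up-sets. [this work] -/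
theorem sum_mul_nonneg_of_unit (hcor : ∀ U V : Finset (Finset γ₁), IsUpperSet (U : Set (Finset γ₁)) → IsUpperSet (V : Set (Finset γ₁)) → 0 ≤ corP P₁ U V)
    (w w' : Finset γ₁ → ℤ) (hval : ∀ x ∈ P₁, w x = -1 ∨ w x = 0 ∨ w x = 1) (hval' : ∀ x ∈ P₁, w' x = -1 ∨ w' x = 0 ∨ w' x = 1)
    (hmono : ∀ x ∈ P₁, ∀ x' ∈ P₁, x ⊆ x' → w x ≤ w x') (hmono' : ∀ x ∈ P₁, ∀ x' ∈ P₁, x ⊆ x' → w' x ≤ w' x')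
    (hpair : ∀ x ∈ P₁, ∀ x' ∈ P₁, x ∪ x' = univ → 0 ≤ w x + w x') (hpair' : ∀ x ∈ P₁, ∀ x' ∈ P₁, x ∪ x' = univ → 0 ≤ w' x + w' x') :
    0 ≤ ∑ x ∈ P₁, w x * w' x := by
  have h := hcor (realize P₁ w) (realize P₁ w') (isUpperSet_realize P₁ w) (isUpperSet_realize P₁ w')
  rw [corP_eq_sum] at h
  have e : ∑ x ∈ P₁, w x * w' x
      = ∑ x ∈ P₁, sgnDiff (realize P₁ w) (refl (realize P₁ w)) x * sgnDiff (realize P₁ w') (refl (realize P₁ w')) x :=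
    Finset.sum_congr rfl fun x hx => by
      rw [sgnDiff_realize_eq hP hd w hval hmono hpair hx, sgnDiff_realize_eq hP hd w' hval' hmono' hpair' hx]
  rw [e]; exact h

/-- First layer of an integer vector: its sign. [this work] -/
def layer1 (k : Finset γ₁ → ℤ) (x : Finset γ₁) : ℤ := if 1 ≤ k x then 1 else if k x ≤ -1 then -1 else 0

/-- Second layer: `±1` where `|k| ≥ 2`. [this work] -/
def layer2 (k : Finset γ₁ → ℤ) (x : Finset γ₁) : ℤ := if 2 ≤ k x then 1 else if k x ≤ -2 then -1 else 0

include hP hd in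
/-- **Acuteness for profile vectors with values in `[-2,2]`** (two layers). [this work] -/
theorem sum_mul_nonneg_of_two (hcor : ∀ U V : Finset (Finset γ₁), IsUpperSet (U : Set (Finset γ₁)) → IsUpperSet (V : Set (Finset γ₁)) → 0 ≤ corP P₁ U V)
    (k k' : Finset γ₁ → ℤ) (hb : ∀ x ∈ P₁, -2 ≤ k x ∧ k x ≤ 2) (hb' : ∀ x ∈ P₁, -2 ≤ k' x ∧ k' x ≤ 2)
    (hmono : ∀ x ∈ P₁, ∀ x' ∈ P₁, x ⊆ x' → k x ≤ k x') (hmono' : ∀ x ∈ P₁, ∀ x' ∈ P₁, x ⊆ x' → k' x ≤ k' x')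
    (hpair : ∀ x ∈ P₁, ∀ x' ∈ P₁, x ∪ x' = univ → 0 ≤ k x + k x') (hpair' : ∀ x ∈ P₁, ∀ x' ∈ P₁, x ∪ x' = univ → 0 ≤ k' x + k' x') :
    0 ≤ ∑ x ∈ P₁, k x * k' x := by
  have hsplit : ∀ x ∈ P₁, k x * k' x
      = layer1 k x * layer1 k' x + layer1 k x * layer2 k' x + layer2 k x * layer1 k' x + layer2 k x * layer2 k' x := by
    intro x hx
    have e1 : k x = layer1 k x + layer2 k x := by
      have := hb x hx; unfold layer1 layer2; split_ifs <;> omega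
    have e2 : k' x = layer1 k' x + layer2 k' x := by
      have := hb' x hx; unfold layer1 layer2; split_ifs <;> omega
    rw [e1, e2]; ring
  rw [Finset.sum_congr rfl hsplit, sum_add_distrib, sum_add_distrib, sum_add_distrib]
  have v1 : ∀ f : Finset γ₁ → ℤ, ∀ x ∈ P₁, layer1 f x = -1 ∨ layer1 f x = 0 ∨ layer1 f x = 1 := by
    intro f x _; unfold layer1; split_ifs <;> simp
  have v2 : ∀ f : Finset γ₁ → ℤ, ∀ x ∈ P₁, layer2 f x = -1 ∨ layer2 f x = 0 ∨ layer2 f x = 1 := by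
    intro f x _; unfold layer2; split_ifs <;> simp
  have m1 : ∀ f : Finset γ₁ → ℤ, (∀ x ∈ P₁, ∀ x' ∈ P₁, x ⊆ x' → f x ≤ f x') → ∀ x ∈ P₁, ∀ x' ∈ P₁, x ⊆ x' → layer1 f x ≤ layer1 f x' := by
    intro f hf x hx x' hx' h; have := hf x hx x' hx' h; unfold layer1; split_ifs <;> omega
  have m2 : ∀ f : Finset γ₁ → ℤ, (∀ x ∈ P₁, ∀ x' ∈ P₁, x ⊆ x' → f x ≤ f x') → ∀ x ∈ P₁, ∀ x' ∈ P₁, x ⊆ x' → layer2 f x ≤ layer2 f x' := by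
    intro f hf x hx x' hx' h; have := hf x hx x' hx' h; unfold layer2; split_ifs <;> omega
  have p1 : ∀ f : Finset γ₁ → ℤ, (∀ x ∈ P₁, ∀ x' ∈ P₁, x ∪ x' = univ → 0 ≤ f x + f x') →
      ∀ x ∈ P₁, ∀ x' ∈ P₁, x ∪ x' = univ → 0 ≤ layer1 f x + layer1 f x' := by
    intro f hf x hx x' hx' h; have := hf x hx x' hx' h; unfold layer1; split_ifs <;> omega
  have p2 : ∀ f : Finset γ₁ → ℤ, (∀ x ∈ P₁, ∀ x' ∈ P₁, x ∪ x' = univ → 0 ≤ f x + f x') →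
      ∀ x ∈ P₁, ∀ x' ∈ P₁, x ∪ x' = univ → 0 ≤ layer2 f x + layer2 f x' := by
    intro f hf x hx x' hx' h; have := hf x hx x' hx' h; unfold layer2; split_ifs <;> omega
  have t11 := sum_mul_nonneg_of_unit hP hd hcor (layer1 k) (layer1 k') (v1 k) (v1 k') (m1 k hmono) (m1 k' hmono') (p1 k hpair) (p1 k' hpair')
  have t12 := sum_mul_nonneg_of_unit hP hd hcor (layer1 k) (layer2 k') (v1 k) (v2 k') (m1 k hmono) (m2 k' hmono') (p1 k hpair) (p2 k' hpair')
  have t21 := sum_mul_nonneg_of_unit hP hd hcor (layer2 k) (layer1 k') (v2 k) (v1 k') (m2 k hmono) (m1 k' hmono') (p2 k hpair) (p1 k' hpair')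
  have t22 := sum_mul_nonneg_of_unit hP hd hcor (layer2 k) (layer2 k') (v2 k) (v2 k') (m2 k hmono) (m2 k' hmono') (p2 k hpair) (p2 k' hpair')
  linarith

end realize

/-! ### The decomposition of `Cor` over the rows of the AND-product, and the theorem -/

/-- **Row decomposition**: `Cor_{P₁ ∧ maj3}(A,B) = Σ_{x∈P₁} [u_A(x)u_B(x) + Σ_i w_{A,i}(x)w_{B,i}(x)]`. [this work] -/
theorem corP_andProd_maj3_eq (P₁ : Finset (Finset γ₁)) (A B : Finset (Finset (γ₁ ⊕ Fin 3))) :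
    corP (andProd P₁ maj3) A B = ∑ x ∈ P₁, (colU A x * colU B x + ∑ i : Fin 3, colW A i x * colW B i x) := by
  rw [corP_eq_sum, andProd_eq_biUnion, sum_biUnion (pairwiseDisjoint_rows P₁ maj3)]
  refine sum_congr rfl fun x _ => ?_
  rw [sum_map, sum_maj3]
  unfold colU colW
  simp only [rowEmb_apply]

/-- The antipodal image of an AND-product with an antipode-free first block is disjoint from it. [this work] -/
theorem disjoint_andProd_refl {δ : Type} [DecidableEq δ] [Fintype δ] {P₁ : Finset (Finset γ₁)} (hd : Disjoint P₁ (refl P₁))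
    (Q : Finset (Finset δ)) : Disjoint (andProd P₁ Q) (refl (andProd P₁ Q)) := by
  rw [refl_andProd, disjoint_left]
  intro t ht ht'
  rw [mem_andProd] at ht ht'
  exact disjoint_left.1 hd ht.1 ht'.1

/-- **THEOREM (AND with a majority-of-three block).**  If `P₁` is an antipode-free up-set with `Cor_{P₁} ≥ 0` on all pairs of up-sets, then
`Cor_{P₁ ∧ maj3}(A,B) ≥ 0` for all up-sets `A, B` of the product cube. [this work] -/
theorem corP_andProd_maj3_nonneg {P₁ : Finset (Finset γ₁)} (hP : IsUpperSet (P₁ : Set (Finset γ₁))) (hd : Disjoint P₁ (refl P₁))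
    (hcor : ∀ U V : Finset (Finset γ₁), IsUpperSet (U : Set (Finset γ₁)) → IsUpperSet (V : Set (Finset γ₁)) → 0 ≤ corP P₁ U V)
    {A B : Finset (Finset (γ₁ ⊕ Fin 3))} (hA : IsUpperSet (A : Set (Finset (γ₁ ⊕ Fin 3)))) (hB : IsUpperSet (B : Set (Finset (γ₁ ⊕ Fin 3)))) :
    0 ≤ corP (andProd P₁ maj3) A B := by
  rw [corP_andProd_maj3_eq]
  -- pointwise: rearrangement + the certificate identity
  have key : ∀ x ∈ P₁, profHi A x * profLo B x + profLo A x * profHi B x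
      ≤ 2 * (colU A x * colU B x + ∑ i : Fin 3, colW A i x * colW B i x) := by
    intro x _
    have bA0 := colW_bounds (A := A) 0 x; have bA1 := colW_bounds (A := A) 1 x; have bA2 := colW_bounds (A := A) 2 x
    have hr : colMin A x * colMax B x + colMed A x * colMed B x + colMax A x * colMin B x
        ≤ colW A 0 x * colW B 0 x + colW A 1 x * colW B 1 x + colW A 2 x * colW B 2 x :=
      rearr3 _ _ _ _ _ _ bA0.1 bA0.2 bA1.1 bA1.2 bA2.1 bA2.2
    have hid := cert_identity (colU A x) (colMin A x) (colMed A x) (colMax A x) (colU B x) (colMin B x) (colMed B x) (colMax B x)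
    have n1 : 0 ≤ (colU A x - colMax A x) * ((colU B x - colMed B x) + (colU B x - colMin B x)) :=
      mul_nonneg (by linarith [colMax_le_colU hA x])
        (by linarith [colMax_le_colU hB x, colMed_le_colMax (A := B) x, colMin_le_colMed (A := B) x])
    have n2 : 0 ≤ (colMax A x - colMed A x) * (colU B x - colMed B x) :=
      mul_nonneg (by linarith [colMed_le_colMax (A := A) x]) (by linarith [colMax_le_colU hB x, colMed_le_colMax (A := B) x])
    have n3 : 0 ≤ (colMed A x - colMin A x) * (colU B x - colMax B x) :=
      mul_nonneg (by linarith [colMin_le_colMed (A := A) x]) (by linarith [colMax_le_colU hB x])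
    rw [Fin.sum_univ_three]
    unfold profHi profLo
    nlinarith [hr, hid, n1, n2, n3]
  -- sum the pointwise bound and use acuteness for the two profile pairs
  have hsum : ∑ x ∈ P₁, (profHi A x * profLo B x + profLo A x * profHi B x)
      ≤ ∑ x ∈ P₁, 2 * (colU A x * colU B x + ∑ i : Fin 3, colW A i x * colW B i x) := sum_le_sum key
  rw [sum_add_distrib, ← mul_sum] at hsum
  have t1 := sum_mul_nonneg_of_two hP hd hcor (profHi A) (profLo B)
    (fun x _ => profHi_bounds (A := A) x) (fun x _ => profLo_bounds (A := B) x)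
    (fun x _ x' _ h => profHi_mono hA h) (fun x _ x' _ h => profLo_mono hB h)
    (fun x _ x' _ h => profHi_pair hA h) (fun x _ x' _ h => profLo_pair hB h)
  have t2 := sum_mul_nonneg_of_two hP hd hcor (profLo A) (profHi B)
    (fun x _ => profLo_bounds (A := A) x) (fun x _ => profHi_bounds (A := B) x)
    (fun x _ x' _ h => profLo_mono hA h) (fun x _ x' _ h => profHi_mono hB h)
    (fun x _ x' _ h => profLo_pair hA h) (fun x _ x' _ h => profHi_pair hB h)
  linarith

/-- The same theorem with the hypothesis in Kleitman-shell form. [this work] -/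
theorem corP_andProd_maj3_nonneg_of_klShell {P₁ : Finset (Finset γ₁)} (hP : IsUpperSet (P₁ : Set (Finset γ₁))) (hd : Disjoint P₁ (refl P₁))
    (hs : KlShell (P₁ ∪ refl P₁))
    {A B : Finset (Finset (γ₁ ⊕ Fin 3))} (hA : IsUpperSet (A : Set (Finset (γ₁ ⊕ Fin 3)))) (hB : IsUpperSet (B : Set (Finset (γ₁ ⊕ Fin 3)))) :
    0 ≤ corP (andProd P₁ maj3) A B :=
  corP_andProd_maj3_nonneg hP hd (fun U V hU hV => by rw [corP_eq_card_sub_card_of_disjoint hd]; exact hs U V hU hV) hA hB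

/-- **The AND-product with a `maj3` block is again an intersecting Kleitman shell.** [this work] -/
theorem klShell_andProd_maj3 {P₁ : Finset (Finset γ₁)} (hP : IsUpperSet (P₁ : Set (Finset γ₁))) (hd : Disjoint P₁ (refl P₁))
    (hcor : ∀ U V : Finset (Finset γ₁), IsUpperSet (U : Set (Finset γ₁)) → IsUpperSet (V : Set (Finset γ₁)) → 0 ≤ corP P₁ U V) :
    KlShell (andProd P₁ maj3 ∪ refl (andProd P₁ maj3)) :=
  klShell_of_corP_nonneg (disjoint_andProd_refl hd maj3) fun _ _ hA hB => corP_andProd_maj3_nonneg hP hd hcor hA hB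

/-- **`TriWIneq` for `P₁ ∧ maj3`** on every index cube, for every intersecting Kleitman shell `P₁`. [this work] -/
theorem triW_nonneg_andProd_maj3 {P₁ : Finset (Finset γ₁)} (hP : IsUpperSet (P₁ : Set (Finset γ₁))) (hd : Disjoint P₁ (refl P₁))
    (hcor : ∀ U V : Finset (Finset γ₁), IsUpperSet (U : Set (Finset γ₁)) → IsUpperSet (V : Set (Finset γ₁)) → 0 ≤ corP P₁ U V)
    (F G : Finset β → Finset (Finset (γ₁ ⊕ Fin 3)))
    (hF : ∀ x, IsUpperSet (F x : Set (Finset (γ₁ ⊕ Fin 3)))) (hG : ∀ x, IsUpperSet (G x : Set (Finset (γ₁ ⊕ Fin 3))))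
    (hFm : Monotone F) (hGm : Monotone G) :
    0 ≤ triW (andProd P₁ maj3) F G :=
  triW_nonneg_of_corP_nonneg (isUpperSet_andProd hP isUpperSet_maj3) (fun _ _ hA hB => corP_andProd_maj3_nonneg hP hd hcor hA hB)
    F G hF hG hFm hGm

/-- Example: `maj3 ∧ maj3` (the smallest AND-product of two non-principal intersecting shells; `n = 6`). [this work] -/
theorem corP_maj3_andProd_maj3_nonneg {A B : Finset (Finset (Fin 3 ⊕ Fin 3))}
    (hA : IsUpperSet (A : Set (Finset (Fin 3 ⊕ Fin 3)))) (hB : IsUpperSet (B : Set (Finset (Fin 3 ⊕ Fin 3)))) :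
    0 ≤ corP (andProd maj3 maj3) A B :=
  corP_andProd_maj3_nonneg isUpperSet_maj3 disjoint_maj3_refl (fun _ _ hU hV => corP_nonneg_of_selfDual maj3_selfDual hU hV) hA hB

/-- Iteration: `(P₁ ∧ maj3) ∧ maj3` is again certified (the theorem feeds itself). [this work] -/
theorem corP_andProd_maj3_maj3_nonneg {P₁ : Finset (Finset γ₁)} (hP : IsUpperSet (P₁ : Set (Finset γ₁))) (hd : Disjoint P₁ (refl P₁))
    (hcor : ∀ U V : Finset (Finset γ₁), IsUpperSet (U : Set (Finset γ₁)) → IsUpperSet (V : Set (Finset γ₁)) → 0 ≤ corP P₁ U V)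
    {A B : Finset (Finset ((γ₁ ⊕ Fin 3) ⊕ Fin 3))}
    (hA : IsUpperSet (A : Set (Finset ((γ₁ ⊕ Fin 3) ⊕ Fin 3)))) (hB : IsUpperSet (B : Set (Finset ((γ₁ ⊕ Fin 3) ⊕ Fin 3)))) :
    0 ≤ corP (andProd (andProd P₁ maj3) maj3) A B :=
  corP_andProd_maj3_nonneg (isUpperSet_andProd hP isUpperSet_maj3) (disjoint_andProd_refl hd maj3)
    (fun _ _ hU hV => corP_andProd_maj3_nonneg hP hd hcor hU hV) hA hB

end FiveUpSet

end Summit.CriticalPhenomena.PercolationContinuityZ3.Theorems
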